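import Summits.NavierStokesRegularity.NavierStokesRegularity.Theorems.StrainClockLocalDefs
import HarnessLib

/-!
# DriftChargedClockDefs — door family S40 «DriftChargedClock»: texts of record (§1–§3)

P0-40 part 1 of 4: §1–§3 (doors `DriftChargedSmoothing` (D1), `DriftChargedTameness` (D2), `DriftChargedStrainFree` (D3),
`ParityRatioDoor` (D4)) of nsreg-p1 g32's `r38/Sketch40.lean` sha16 6cf784e4a0d91d3a (ROUND-38 S40 «DriftChargedClock»,
memo c2f04749b4dda388 / v1.1 de833dab5ad7c014), every declaration byte-identical, order preserved; §0 of the sketch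
(`IsStrainPenalisedArgmax`, `StrainThresholdWeightedOn`, `strainThresholdWeightedOn_holds` — Sketch39 support) is DROPPED and
replaced by `import …Theorems.StrainClockLocalDefs` (P0-39 part 1, p667521), exactly as memo §8 prescribes; cut prepared by
ns-s29-p2 g5, `--supports stmt-NavierStokesRegularity-0056 --as helper`, `--kind definition`.  The sketch's module docstring
follows verbatim.

HONEST FRAME: door family S40 «DriftChargedClock» = level-charged / velocity-free strain-clock CRITERIA about HYPOTHETICAL blow-up
profiles; items 0056 `NoTypeII`, 10661 and NS regularity are NOT proved; nothing here is a route or a summit statement.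
-/

/-!
# Sketch40 — door family S40 «DriftChargedClock» (nsreg-p1 g32, ROUND-38): texts of record + kernel-checked compositions

S39 (ROUND-37) kept E1_S♭'s penalisation weight `w_ε = (1+ε|x|²)⁻¹` at FIXED resolution `ε = R⁻²` and paid the
transport allowance `√ε·|u(x̄)|·q` of the growth law (p660752) with a GLOBAL velocity bound `|u| ≤ U`; that bound
entered frame and conclusion (`η(ε) = 6νε + √εU`) and made the forward door C3 a bound in a bounded-velocity
(Serrin-class) frame rather than a continuation criterion. S40 charges the drift RELATIVELY and AT A LEVEL: the
hypothesis is asked only at exact `ε`-penalised maximisers whose weighted strain exceeds a level `ℓ ≥ 0`, and it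
bounds the TOTAL feed — strain feed plus drift across the resolution, `H + |u(x̄)|·q/R` — by `c·q²`. Then `U`
disappears from frame AND conclusion:

(D1) «DriftChargedSmoothing» — forward, in S33's blow-up-PERMITTING frame (classical on `[0,T)`, gradient bounded on
closed sub-slabs only, velocity free): `(1+ε|x|²)⁻¹⟪∇u(t,x)e,e⟫ ≤ ℓ + 6νε/κ + 1/(κ(t−t₀))` for `t ∈ (t₀,T)` — a
weighted strain bound UNIFORM UP TO `T` inside the resolved ball, i.e. (by the local gradient criteria for suitable
solutions, literature) no singular point there: a LOCAL continuation-grade door at one centre.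
(D2) «DriftChargedTameness» — ancient, gradient-bounded, velocity UNBOUNDED allowed: `w_ε q ≤ ℓ + 6νε/κ` everywhere.
(D3) «DriftChargedStrainFree» — the same for all `ε ∈ (0,1]` and all levels `ℓ > 0` forces `⟪∇u(s,x)e,e⟫ = 0` for
all `s < 0`, `x`, `e`: the ancient flow is slice-wise STRAIN-FREE (an infinitesimal rigid motion; rigid rotations
`u = Ω × x` inhabit frame and conclusion non-trivially — no velocity bound is assumed, so «constant» is not claimed).
(D4) «ParityRatioDoor» — S38-A0 sharpened from `c < 1` to PARITY ITSELF: feed `≤ q²` (at most parity) at the charged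
almost-maximisers above a level already gives extension past `T` (constant barrier, `φ ≡ 0`; the clock need not run
forward, it must only not be beaten). Blow-up therefore needs STRICT super-parity `H > q²` on the charge set at times
accumulating at `T`.

* §0 support copied verbatim from Sketch39 (P0-39 pending): `IsStrainPenalisedArgmax`, plate text E2_S^w
  «StrainThresholdWeightedOn» + its by-name closer over p664793 — DROP on landing after P0-39.
* §1 D1 · §2 D2, D3 · §3 D4 · §4 compositions (`driftSlab_bound` = the level-charged weighted one-slab bound) ·
  §5 closers (ALL FOUR DOORS CLOSED; `lean check --axioms`: propext / Classical.choice / Quot.sound each; no `#print axioms` lines, ref3 F4).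

HONEST LABEL: conditional criteria. D1 = C3/A0 made local AND velocity-free (variant+, same engine: p655218 device via
p664793, E1_S♭ p660752); D2/D3 = Liouville-type statements for gradient-bounded ancient flows WITHOUT a velocity
bound; D4 = A0 with the sharp constant. WHAT THIS IS NOT: item 0056 `NoTypeII`, item 10661 `TypeIliouvilleL` and NS
regularity are NOT proved; no Literature fact is a hypothesis; the local-regularity consequence of D1 (Gustafson–
Kang–Tsai-type gradient criteria + Korn) is NOT typed — D1 concludes the bound; nothing here is a route or a summit
statement (`--supports stmt-NavierStokesRegularity-0056 --as helper`, Theorems-only landings by the S-lane).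
-/

noncomputable section

open MeasureTheory Set Function Filter Metric Real InnerProductSpace
open _root_.Topology
open scoped ENNReal NNReal RealInnerProductSpace ContDiff Laplacian Interval
open Literature.Analysis Literature.Analysis.FluidPDE
open Literature.Analysis.FluidPDE.VorticityDirectionDynamics

set_option linter.dupNamespace false

namespace Summit.NavierStokesRegularity.NavierStokesRegularity.Theorems.StrainDoors

open Summit.NavierStokesRegularity.NavierStokesRegularity.Theorems.ArgmaxDoors

-- nested operator types (second derivatives)
set_option maxSynthPendingDepth 3

/-! ## §1 Door D1 «DriftChargedSmoothing» (forward, velocity-free, level-charged) -/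

/-- door S40-D1 «DriftChargedSmoothing» (forward; LOCAL, VELOCITY-FREE a-priori bound). `ν > 0`, `0 ≤ t₀ < T`,
resolution `ε > 0`, level `ℓ ≥ 0`, `c < 1`; `(u,p)` classical on `[0,T)` (S33 frame) with `∇u` bounded on every
CLOSED sub-slab `[t₀,T']`, `T' < T` — NO velocity bound, so the frame is inhabited by every smooth solution up to a
putative first singular time `T`. HYPOTHESIS, charged at every EXACT `ε`-penalised strain maximiser `(x,e)` at times
`t ∈ [t₀,T)` whose weighted strain exceeds the level, `(1+ε|x|²)⁻¹⟪∇u e,e⟫ > ℓ`: the TOTAL FEED — strain feed plus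
drift across the resolution — is sub-parity, `¼(|ω|²−⟪ω,e⟫²) − ∇²p(e,e) + √ε·|u(x)|·⟪∇u e,e⟫ ≤ c·⟪∇u e,e⟫²`.
CONCLUSION: for every `t ∈ (t₀,T)`, `x`, unit `e`: `(1+ε|x|²)⁻¹⟪∇u(t,x)e,e⟫ ≤ ℓ + 6νε/(1−c) + 1/((1−c)(t−t₀))` —
uniform as `t ↑ T`, no datum, no `ν⁻¹`, no `U`. -/
def DriftChargedSmoothing : Prop :=
  ∀ (ν T t₀ ε ℓ c : ℝ), 0 < ν → 0 ≤ t₀ → t₀ < T → 0 < ε → 0 ≤ ℓ → c < 1 →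
    ∀ (u : ℝ → (EuclideanSpace ℝ (Fin 3)) → (EuclideanSpace ℝ (Fin 3)))
      (p : ℝ → (EuclideanSpace ℝ (Fin 3)) → ℝ),
      IsClassicalNSSolutionOn (Ico 0 T) ν 0 u p →
      (∀ T' : ℝ, T' < T → ∃ K : ℝ, ∀ t ∈ Icc t₀ T', ∀ x : EuclideanSpace ℝ (Fin 3), ‖fderiv ℝ (u t) x‖ ≤ K) →
      (∀ t ∈ Ico t₀ T, ∀ (x e : EuclideanSpace ℝ (Fin 3)), IsStrainPenalisedArgmax ε u t x e →
        ℓ < (1 + ε * ‖x‖ ^ 2)⁻¹ * strainQuad u t x e →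
        strainFeed u p t x e + Real.sqrt ε * ‖u t x‖ * strainQuad u t x e ≤ c * strainQuad u t x e ^ 2) →
      ∀ t ∈ Ioo t₀ T, ∀ (x e : EuclideanSpace ℝ (Fin 3)), ‖e‖ = 1 →
        (1 + ε * ‖x‖ ^ 2)⁻¹ * strainQuad u t x e ≤ ℓ + 6 * ν * ε / (1 - c) + 1 / ((1 - c) * (t - t₀))

/-! ## §2 Doors D2 «DriftChargedTameness», D3 «DriftChargedStrainFree» (ancient, no velocity bound) -/

/-- door S40-D2 «DriftChargedTameness» (ancient; quantitative). THE GRADIENT-BOUNDED ANCIENT FRAME: `ν > 0`; `(u,p)`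
classical on every closed slab `[s₁,s₂] ⊂ (−∞,0)`; `‖∇u‖ ≤ L` on `(−∞,0) × ℝ³`; NO velocity bound (linear flows
`u = A(s)x` and rigid rotations inhabit it). Resolution `ε > 0`, level `ℓ ≥ 0`, `c < 1`. HYPOTHESIS as in D1 at
times `s < 0`. CONCLUSION: `(1+ε|x|²)⁻¹⟪∇u(s,x)e,e⟫ ≤ ℓ + 6νε/(1−c)` for all `s < 0`, `x`, unit `e`. -/
def DriftChargedTameness : Prop :=
  ∀ (ν L ε ℓ c : ℝ), 0 < ν → 0 < ε → 0 ≤ ℓ → c < 1 →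
    ∀ (u : ℝ → (EuclideanSpace ℝ (Fin 3)) → (EuclideanSpace ℝ (Fin 3)))
      (p : ℝ → (EuclideanSpace ℝ (Fin 3)) → ℝ),
      (∀ s₁ s₂ : ℝ, s₁ < s₂ → s₂ < 0 → IsClassicalNSSolutionOn (Icc s₁ s₂) ν 0 u p) →
      (∀ s : ℝ, s < 0 → ∀ x : EuclideanSpace ℝ (Fin 3), ‖fderiv ℝ (u s) x‖ ≤ L) →
      (∀ s : ℝ, s < 0 → ∀ (x e : EuclideanSpace ℝ (Fin 3)), IsStrainPenalisedArgmax ε u s x e →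
        ℓ < (1 + ε * ‖x‖ ^ 2)⁻¹ * strainQuad u s x e →
        strainFeed u p s x e + Real.sqrt ε * ‖u s x‖ * strainQuad u s x e ≤ c * strainQuad u s x e ^ 2) →
      ∀ s : ℝ, s < 0 → ∀ (x e : EuclideanSpace ℝ (Fin 3)), ‖e‖ = 1 →
        (1 + ε * ‖x‖ ^ 2)⁻¹ * strainQuad u s x e ≤ ℓ + 6 * ν * ε / (1 - c)

/-- door S40-D3 «DriftChargedStrainFree» (ancient; Liouville-type, no velocity bound). Same frame; HYPOTHESIS of D2
for EVERY resolution `ε ∈ (0,1]` and EVERY level `ℓ > 0`. CONCLUSION: `⟪∇u(s,x)e,e⟫ = 0` for all `s < 0`, `x`, `e` —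
every slice is strain-free (an infinitesimal rigid motion). -/
def DriftChargedStrainFree : Prop :=
  ∀ (ν L c : ℝ), 0 < ν → c < 1 →
    ∀ (u : ℝ → (EuclideanSpace ℝ (Fin 3)) → (EuclideanSpace ℝ (Fin 3)))
      (p : ℝ → (EuclideanSpace ℝ (Fin 3)) → ℝ),
      (∀ s₁ s₂ : ℝ, s₁ < s₂ → s₂ < 0 → IsClassicalNSSolutionOn (Icc s₁ s₂) ν 0 u p) →
      (∀ s : ℝ, s < 0 → ∀ x : EuclideanSpace ℝ (Fin 3), ‖fderiv ℝ (u s) x‖ ≤ L) →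
      (∀ ε : ℝ, 0 < ε → ε ≤ 1 → ∀ ℓ : ℝ, 0 < ℓ →
        ∀ s : ℝ, s < 0 → ∀ (x e : EuclideanSpace ℝ (Fin 3)), IsStrainPenalisedArgmax ε u s x e →
          ℓ < (1 + ε * ‖x‖ ^ 2)⁻¹ * strainQuad u s x e →
          strainFeed u p s x e + Real.sqrt ε * ‖u s x‖ * strainQuad u s x e ≤ c * strainQuad u s x e ^ 2) →
      ∀ s : ℝ, s < 0 → ∀ (x e : EuclideanSpace ℝ (Fin 3)), strainQuad u s x e = 0

/-! ## §3 Door D4 «ParityRatioDoor» (forward; S38-A0 at the sharp constant) -/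

/-- door S40-D4 «ParityRatioDoor» (regularity criterion; AT MOST PARITY). S38-A0's frame verbatim: `ν > 0`,
`0 ≤ t₀ < T`, `l₀ ≥ 0`, `0 < δ < 1`, `(u,p)` in the S33 frame with slab Sobolev bounds. HYPOTHESIS, charged at every
`(1−δ)`-ALMOST strain maximiser `(x,e)` at times `t ∈ [t₀,T)` with `⟪∇u e,e⟫ > l₀`: the strain feed does NOT EXCEED
the Riccati credit, `¼(|ω|² − ⟪ω,e⟫²) − ∇²p(e,e) ≤ ⟪∇u e,e⟫²` (S38-A0 asked `≤ c·⟪∇u e,e⟫²` with `c < 1`).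
CONCLUSION: extension past `T`. -/
def ParityRatioDoor : Prop :=
  ∀ (ν T t₀ l₀ δ : ℝ), 0 < ν → 0 ≤ t₀ → t₀ < T → 0 ≤ l₀ → 0 < δ → δ < 1 →
    ∀ (u : ℝ → (EuclideanSpace ℝ (Fin 3)) → (EuclideanSpace ℝ (Fin 3)))
      (p : ℝ → (EuclideanSpace ℝ (Fin 3)) → ℝ),
      IsClassicalNSSolutionOn (Ico 0 T) ν 0 u p →
      (∀ T'' < T, HasBoundedSobolevNormsOn (Icc 0 T'') u) →
      (∀ t ∈ Ico t₀ T, ∀ (x e : EuclideanSpace ℝ (Fin 3)), IsStrainAlmostArgmax δ u t x e →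
        l₀ < strainQuad u t x e → strainFeed u p t x e ≤ strainQuad u t x e ^ 2) →
      HasSobolevExtensionPast ν u T


end Summit.NavierStokesRegularity.NavierStokesRegularity.Theorems.StrainDoors

end
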